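import Summits.BirchSwinnertonDyer.BirchSwinnertonDyer.Theorems.ResidualThetaTransportAtTwoPlusDualLayerForms
import Summits.BirchSwinnertonDyer.BirchSwinnertonDyer.Theorems.ResidualThetaTransportAtTwoPlusDualThetaAlgebraCoeff
import Literature.NumberTheory.EllipticCurves.CasselsTateLevelAssembly
import HarnessLib

/-!
# θ-EXTRACTION: invariant, norm-compatible layer forms vanishing on the honest classes are zero

Support file for RTT P6 `ResidualLambdaFormulaNegDiscAtTwo` (stmt-BirchSwinnertonDyer-23110), line `hplusdual`, stub `stub_iso`
(ISO = Kim 2007 Prop. 3.15 at `p = 2`, θ-plan; LEAD g13 2026-08-28 22:31Z decision (1)). Setting: a dual pair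
`toDual : X ≅ Hom(S, ℚ/ℤ)` of `(S, φ − 1)` with `X ≃ₗ[Λ] Λ` ((R1)@2 currency), layers `S_n = S[p^J, φ^{pⁿ} = 1]` (cyclic,
`exists_generator_torsionBy_omega`), forms `B_n : S_n × S_n → M ↪ ℚ/ℤ` biadditive, `φ`-invariant, norm-compatible
(`B_n(N_{n+1/n} s, t) = B_{n+1}(s, t)`), vanishing on `Q_k(φ)S_{n_k} × Q_k(φ)S_{n_k}` for palindromic `Q_k` with `Q_k(1+T)²`
distinguished of degree `≤ p^{n_k} − N` for every `N`. CONCLUSION `forall_layerForm_eq_zero`: every `B_n` is zero; at `p = 2`,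
`n_k = 2k`, `Q_k(φ) = ω̃⁻_{2k}(φ − 1)`: `forall_layerForm_eq_zero_two` (the LEAD's binder shape).

Proof: `θ_n := e(x_{g_n})` (θ-dictionary of `…PlusDualLayerForms`) at generators `g_n`; (V) + palindromy give
`θ_{n_k}·Q_k(1+T)² ∈ I(n_k, J)` (`e_mul_sq_mem_of_vanishing`); norm compatibility + cor-surjectivity + palindromy of the norm +
the colon ideal give `w_n θ_{n+1} − θ_n ∈ I(n, J)` (`exists_mul_e_sub_e_mem_of_norm`); the θ-algebra with coefficients
(`forall_mem_omegaIdeal_of_compatible_coeff`) forces `θ_n ∈ I(n, J)`, i.e. `B_n = 0` (`form_eq_zero_of_e_mem`).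

References: B.D. Kim, Compos. Math. 143 (2007), Props. 3.14–3.18; R. Greenberg, LNM 1716 (1999), §1, §4;
L. Washington, *Introduction to Cyclotomic Fields*, §13.2.
-/

set_option autoImplicit false
-- D-0017: single-problem summit, so `Summit.BirchSwinnertonDyer.BirchSwinnertonDyer.…` repeats a namespace BY DESIGN.
set_option linter.dupNamespace false

noncomputable section

open scoped Classical
open Polynomial Finset Literature.NumberTheory.EllipticCurves Literature.NumberTheory.EllipticCurves.IwasawaDual

namespace Summit.BirchSwinnertonDyer.BirchSwinnertonDyer.Theorems.ResidualThetaLayer.PlusDual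

/-! ## §1 Vanishing and norm compatibility in the θ-dictionary -/

section Theta

variable {p : ℕ} [hp : Fact p.Prime]
variable {S : Type*} [AddCommGroup S] {φ : AddMonoid.End S}
variable {Xd : Type*} [AddCommGroup Xd] [Module (PowerSeries ℤ_[p]) Xd] {toDual : Xd →+ (S →+ AddCircle (1 : ℚ))}
variable {M : Type*} [AddCommGroup M]

/-- **VANISHING ON `Q(φ)A × Q(φ)A` ⟹ `θ·Q(1+T)² ∈ I(n, J)`.** For a biadditive `φ`-invariant form `B` on the layer `A = S[p^J, ω_n]`
with `B(Q(φ)s, Q(φ)t) = 0` for all `s, t ∈ A`, and `Q` palindromic modulo `ω_n` (`(1+T)^d Q((1+T)^{pⁿ−1}) ≡ Q(1+T)`), the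
θ-encoding of `B(·, g)` satisfies `e(x_g)·Q(1+T)² ∈ I(n, J)` (slot transfer gives `B(Qs, Qg) = B(Q^†Q s, g)`, i.e.
`Q^†(1+T)·Q(1+T)·x_g` kills `A`). With `Q(φ) = ω̃⁻_{2k}(φ − 1)` the vanishing is the isotropy of the honest plus classes
((d′) `iota_image_eq_image_omegaMinus` + ISO-1c). [cite: BDKim2007, Prop. 3.15 (proof), Prop. 3.14] -/
theorem e_mul_sq_mem_of_vanishing (h : IsDualPair p (φ - 1) toDual) (e : Xd ≃ₗ[PowerSeries ℤ_[p]] PowerSeries ℤ_[p])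
    {n J : ℕ} {A : AddSubgroup S} (hA : ∀ s, s ∈ A ↔ p ^ J • s = 0 ∧ (φ ^ p ^ n) s = s)
    (j : M →+ AddCircle (1 : ℚ)) (B : S → S → M)
    (hadd₁ : ∀ s₁ ∈ A, ∀ s₂ ∈ A, ∀ t ∈ A, B (s₁ + s₂) t = B s₁ t + B s₂ t)
    (hadd₂ : ∀ s ∈ A, ∀ t₁ ∈ A, ∀ t₂ ∈ A, B s (t₁ + t₂) = B s t₁ + B s t₂)
    (hinv : ∀ s ∈ A, ∀ t ∈ A, B (φ s) (φ t) = B s t)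
    {g : S} (hg : g ∈ A) {xg : Xd} (hxg : ∀ s ∈ A, toDual xg s = j (B s g)) (Q : ℤ[X])
    (hV : ∀ s ∈ A, ∀ t ∈ A, B (aeval φ Q s) (aeval φ Q t) = 0) {d : ℕ}
    (hpal : (1 + PowerSeries.X : PowerSeries ℤ_[p]) ^ d *
        aeval ((1 + PowerSeries.X : PowerSeries ℤ_[p]) ^ (p ^ n - 1)) Q - aeval (1 + PowerSeries.X : PowerSeries ℤ_[p]) Q ∈
      Ideal.span {(((X + 1 : ℤ_[p][X]) ^ p ^ n - 1 : ℤ_[p][X]) : PowerSeries ℤ_[p])}) :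
    e xg * (aeval (1 + PowerSeries.X : PowerSeries ℤ_[p]) Q) ^ 2 ∈
      Ideal.span {(((X + 1 : ℤ_[p][X]) ^ p ^ n - 1 : ℤ_[p][X]) : PowerSeries ℤ_[p])} ⊔
        Ideal.span {PowerSeries.C ((p : ℤ_[p]) ^ J)} := by
  have hφA : ∀ s ∈ A, φ s ∈ A := fun s hs ↦ phi_mem_of_layer hA hs
  have hfix : ∀ s ∈ A, (φ ^ p ^ n) s = s := fun s hs ↦ ((hA s).mp hs).2
  have hN : 0 < p ^ n := pow_pos hp.out.pos n
  set Qd : PowerSeries ℤ_[p] := aeval ((1 + PowerSeries.X : PowerSeries ℤ_[p]) ^ (p ^ n - 1)) Q with hQd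
  set QΛ : PowerSeries ℤ_[p] := aeval (1 + PowerSeries.X : PowerSeries ℤ_[p]) Q with hQΛ
  have h1 : e ((Qd * QΛ) • xg) ∈ Ideal.span {(((X + 1 : ℤ_[p][X]) ^ p ^ n - 1 : ℤ_[p][X]) : PowerSeries ℤ_[p])} ⊔
      Ideal.span {PowerSeries.C ((p : ℤ_[p]) ^ J)} := by
    refine e_mem_omegaIdeal_of_forall h e hA fun s hs ↦ ?_
    rw [mul_smul, hQd, toDual_aeval_pow_smul h, hQΛ, toDual_aeval_one_add_X_smul h]
    have hcomm : aeval φ Q (aeval (φ ^ (p ^ n - 1)) Q s) = aeval (φ ^ (p ^ n - 1)) Q (aeval φ Q s) := by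
      rw [aeval_pow_eq_aeval_comp]
      show (aeval φ Q * aeval φ (Q.comp (X ^ (p ^ n - 1)))) s = (aeval φ (Q.comp (X ^ (p ^ n - 1))) * aeval φ Q) s
      rw [← map_mul, ← map_mul, mul_comm]
    rw [hcomm, hxg _ (aeval_pow_apply_mem_of_phi_mem hφA _ Q (aeval_apply_mem_of_phi_mem hφA Q hs)),
      ← form_apply_aeval hφA B hadd₁ hadd₂ hinv hN hfix Q (aeval_apply_mem_of_phi_mem hφA Q hs) hg, hV s hs g hg, map_zero]
  rw [map_smul, smul_eq_mul] at h1
  have h2 : (1 + PowerSeries.X : PowerSeries ℤ_[p]) ^ d * Qd - QΛ ∈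
      Ideal.span {(((X + 1 : ℤ_[p][X]) ^ p ^ n - 1 : ℤ_[p][X]) : PowerSeries ℤ_[p])} ⊔
        Ideal.span {PowerSeries.C ((p : ℤ_[p]) ^ J)} := Ideal.mem_sup_left hpal
  have e1 : e xg * QΛ ^ 2 = (1 + PowerSeries.X : PowerSeries ℤ_[p]) ^ d * (Qd * QΛ * e xg) -
      ((1 + PowerSeries.X : PowerSeries ℤ_[p]) ^ d * Qd - QΛ) * (QΛ * e xg) := by ring
  rw [e1]
  exact sub_mem (Ideal.mul_mem_left _ _ h1) (Ideal.mul_mem_right _ _ h2)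

/-- **NORM COMPATIBILITY ⟹ `w·θ_{n+1} − θ_n ∈ I(n, J)`.** Let `B` (layer `n`, subgroup `A`) and `B'` (layer `n+1`, subgroup `A'`) be
biadditive `φ`-invariant forms with `B(N s, t) = B'(s, t)` for the relative norm `N = ∑_{i<p} φ^{pⁿ i} = Φ_{p^{n+1}}(φ)`, let `g'`
generate `A'` over `ℤ[φ]`, `g ∈ A`, and let `x_g, x_{g'}` encode `B(·, g)`, `B'(·, g')`. Then `w·e(x_{g'}) − e(x_g) ∈ I(n, J)` for some
`w ∈ Λ`. (Cor-surjectivity `N A' = A` (`norm_image_torsionBy_eq`) writes `g = a(φ)·N g'`; semilinearity; `B(N s, N g') =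
B'(ν^†(φ) s, g')` makes `ν·e(x') − ν^†·e(x_{g'})` kill `A'`; palindromy `ν^† ≡ ν (mod ω_{n+1})` and the colon ideal
`(I(n+1,J) : ν) = I(n,J)` finish.) [cite: BDKim2007, Prop. 3.15 (proof, «Cor^m_n(H_m[p^j]) = H_n[p^j]»)] [cite: Washington1997, §13.2] -/
theorem exists_mul_e_sub_e_mem_of_norm (h : IsDualPair p (φ - 1) toDual) (e : Xd ≃ₗ[PowerSeries ℤ_[p]] PowerSeries ℤ_[p])
    {n J : ℕ} {A A' : AddSubgroup S} (hA : ∀ s, s ∈ A ↔ p ^ J • s = 0 ∧ (φ ^ p ^ n) s = s)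
    (hA' : ∀ s, s ∈ A' ↔ p ^ J • s = 0 ∧ (φ ^ p ^ (n + 1)) s = s)
    (j : M →+ AddCircle (1 : ℚ)) (B B' : S → S → M)
    (hadd₁ : ∀ s₁ ∈ A, ∀ s₂ ∈ A, ∀ t ∈ A, B (s₁ + s₂) t = B s₁ t + B s₂ t)
    (hadd₂ : ∀ s ∈ A, ∀ t₁ ∈ A, ∀ t₂ ∈ A, B s (t₁ + t₂) = B s t₁ + B s t₂)
    (hinv : ∀ s ∈ A, ∀ t ∈ A, B (φ s) (φ t) = B s t)
    (hadd₁' : ∀ s₁ ∈ A', ∀ s₂ ∈ A', ∀ t ∈ A', B' (s₁ + s₂) t = B' s₁ t + B' s₂ t)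
    (hadd₂' : ∀ s ∈ A', ∀ t₁ ∈ A', ∀ t₂ ∈ A', B' s (t₁ + t₂) = B' s t₁ + B' s t₂)
    (hinv' : ∀ s ∈ A', ∀ t ∈ A', B' (φ s) (φ t) = B' s t)
    (hnorm : ∀ s ∈ A', ∀ t ∈ A, B ((∑ i ∈ range p, (φ ^ p ^ n) ^ i : AddMonoid.End S) s) t = B' s t)
    {g g' : S} (hg : g ∈ A) (hg' : g' ∈ A')
    (hgen' : ∀ t ∈ A', ∃ c : Fin (p ^ (n + 1)) → ℕ, t = ∑ i, c i • (φ ^ (i : ℕ)) g')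
    {xg xg' : Xd} (hxg : ∀ s ∈ A, toDual xg s = j (B s g)) (hxg' : ∀ s ∈ A', toDual xg' s = j (B' s g')) :
    ∃ w : PowerSeries ℤ_[p], w * e xg' - e xg ∈
      Ideal.span {(((X + 1 : ℤ_[p][X]) ^ p ^ n - 1 : ℤ_[p][X]) : PowerSeries ℤ_[p])} ⊔
        Ideal.span {PowerSeries.C ((p : ℤ_[p]) ^ J)} := by
  have hφA' : ∀ s ∈ A', φ s ∈ A' := fun s hs ↦ phi_mem_of_layer hA' hs
  have hfix' : ∀ s ∈ A', (φ ^ p ^ (n + 1)) s = s := fun s hs ↦ ((hA' s).mp hs).2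
  have hN' : 0 < p ^ (n + 1) := pow_pos hp.out.pos (n + 1)
  set Φ : ℤ[X] := cyclotomic (p ^ (n + 1)) ℤ with hΦ
  have hN : (aeval φ Φ : AddMonoid.End S) = ∑ i ∈ range p, (φ ^ p ^ n) ^ i := by
    rw [hΦ, cyclotomic_prime_pow_eq_geom_sum hp.out, map_sum]
    simp only [map_pow, aeval_X]
  -- cor-surjectivity `N A' = A`
  have himage : (⇑(aeval φ Φ)) '' {s : S | p ^ J • s = 0 ∧ (φ ^ p ^ (n + 1)) s = s} =
      {s : S | p ^ J • s = 0 ∧ (φ ^ p ^ n) s = s} := by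
    have := norm_image_torsionBy_eq h e (Nat.le_add_right n 1) J
    rwa [Nat.add_sub_cancel_left, pow_one, ← hN] at this
  have hNmem : ∀ s ∈ A', aeval φ Φ s ∈ A := fun s hs ↦ by
    rw [hA]
    have h1 : aeval φ Φ s ∈ (⇑(aeval φ Φ)) '' {s : S | p ^ J • s = 0 ∧ (φ ^ p ^ (n + 1)) s = s} :=
      Set.mem_image_of_mem _ ((hA' s).mp hs)
    rwa [himage] at h1
  -- `x'` encodes `B(·, N g')` on `A`
  obtain ⟨x', hx'⟩ := exists_toDual_eq_on h A j (fun s ↦ B s (aeval φ Φ g'))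
    (fun s₁ h₁ s₂ h₂ ↦ hadd₁ s₁ h₁ s₂ h₂ _ (hNmem g' hg'))
  -- (i) `g = a(φ)·N g'`
  have hgim : g ∈ (⇑(aeval φ Φ)) '' {s : S | p ^ J • s = 0 ∧ (φ ^ p ^ (n + 1)) s = s} := by
    rw [himage]; exact (hA g).mp hg
  obtain ⟨s₀, hs₀, hs₀g⟩ := hgim
  obtain ⟨c, hc⟩ := hgen' s₀ ((hA' s₀).mpr hs₀)
  have hgexp : g = ∑ i, c i • (φ ^ (i : ℕ)) (aeval φ Φ g') := by
    rw [← hs₀g, hc, map_sum]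
    exact Finset.sum_congr rfl fun i _ ↦ by rw [map_nsmul, aeval_apply_pow_apply]
  have h1 := e_sub_mul_e_mem_of_expansion h e hA j B hadd₂ hinv (hNmem g' hg') c hx' (xt := xg)
    (fun s hs ↦ by rw [← hgexp]; exact hxg s hs)
  -- (ii) `ν·x' − ν^†·x_{g'}` kills `A'`
  have h2 : e ((aeval (1 + PowerSeries.X : PowerSeries ℤ_[p]) Φ) • x' -
      (aeval ((1 + PowerSeries.X : PowerSeries ℤ_[p]) ^ (p ^ (n + 1) - 1)) Φ) • xg') ∈
      Ideal.span {(((X + 1 : ℤ_[p][X]) ^ p ^ (n + 1) - 1 : ℤ_[p][X]) : PowerSeries ℤ_[p])} ⊔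
        Ideal.span {PowerSeries.C ((p : ℤ_[p]) ^ J)} := by
    refine e_mem_omegaIdeal_of_forall h e hA' fun s hs ↦ ?_
    rw [map_sub, AddMonoidHom.sub_apply, toDual_aeval_one_add_X_smul h, toDual_aeval_pow_smul h, hx' _ (hNmem s hs),
      hxg' _ (aeval_pow_apply_mem_of_phi_mem hφA' _ _ hs), sub_eq_zero,
      ← form_apply_aeval hφA' B' hadd₁' hadd₂' hinv' hN' hfix' Φ hs hg']
    have h3 := hnorm s hs _ (hNmem g' hg')
    rw [← hN] at h3
    rw [h3]
  rw [map_sub, map_smul, map_smul, smul_eq_mul, smul_eq_mul] at h2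
  -- (iii) palindromy of `ν` and the colon ideal
  have h3 : aeval (1 + PowerSeries.X : PowerSeries ℤ_[p]) Φ * (e x' - e xg') ∈
      Ideal.span {(((X + 1 : ℤ_[p][X]) ^ p ^ (n + 1) - 1 : ℤ_[p][X]) : PowerSeries ℤ_[p])} ⊔
        Ideal.span {PowerSeries.C ((p : ℤ_[p]) ^ J)} := by
    have hpal := aeval_norm_adjoint_sub_mem p n
    have e1 : aeval (1 + PowerSeries.X : PowerSeries ℤ_[p]) Φ * (e x' - e xg') =
        (aeval (1 + PowerSeries.X : PowerSeries ℤ_[p]) Φ * e x' -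
            aeval ((1 + PowerSeries.X : PowerSeries ℤ_[p]) ^ (p ^ (n + 1) - 1)) Φ * e xg') +
          (aeval ((1 + PowerSeries.X : PowerSeries ℤ_[p]) ^ (p ^ (n + 1) - 1)) Φ -
            aeval (1 + PowerSeries.X : PowerSeries ℤ_[p]) Φ) * e xg' := by ring
    rw [e1]
    exact add_mem h2 (Ideal.mul_mem_right _ _ (Ideal.mem_sup_left hpal))
  have h4 : e x' - e xg' ∈ Ideal.span {(((X + 1 : ℤ_[p][X]) ^ p ^ n - 1 : ℤ_[p][X]) : PowerSeries ℤ_[p])} ⊔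
      Ideal.span {PowerSeries.C ((p : ℤ_[p]) ^ J)} := by
    refine mem_omegaIdeal_of_geom_sum_mul_mem p J (Nat.le_add_right n 1) ?_
    have hcoe : ((∑ i ∈ range (p ^ (n + 1 - n)), ((X + 1 : ℤ_[p][X]) ^ p ^ n) ^ i : ℤ_[p][X]) : PowerSeries ℤ_[p]) =
        aeval (1 + PowerSeries.X : PowerSeries ℤ_[p]) Φ := by
      rw [Nat.add_sub_cancel_left, pow_one, hΦ, aeval_cyclotomic_prime_pow_succ _ hp.out,
        ← Polynomial.coeToPowerSeries.ringHom_apply, map_sum]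
      simp only [Polynomial.coeToPowerSeries.ringHom_apply, Polynomial.coe_pow, Polynomial.coe_add, Polynomial.coe_X,
        Polynomial.coe_one, add_comm]
    rw [hcoe]
    exact h3
  refine ⟨∑ i, ((c i : ℕ) : PowerSeries ℤ_[p]) * (1 + PowerSeries.X : PowerSeries ℤ_[p]) ^ ((i : ℕ) * (p ^ n - 1)), ?_⟩
  have e2 : (∑ i, ((c i : ℕ) : PowerSeries ℤ_[p]) * (1 + PowerSeries.X : PowerSeries ℤ_[p]) ^ ((i : ℕ) * (p ^ n - 1))) * e xg' - e xg =
      (∑ i, ((c i : ℕ) : PowerSeries ℤ_[p]) * (1 + PowerSeries.X : PowerSeries ℤ_[p]) ^ ((i : ℕ) * (p ^ n - 1))) * (e xg' - e x') -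
        (e xg - (∑ i, ((c i : ℕ) : PowerSeries ℤ_[p]) * (1 + PowerSeries.X : PowerSeries ℤ_[p]) ^ ((i : ℕ) * (p ^ n - 1))) * e x') := by
    ring
  rw [e2]
  refine sub_mem (Ideal.mul_mem_left _ _ ?_) h1
  have h5 : e xg' - e x' = -(e x' - e xg') := (neg_sub _ _).symm
  rw [h5]
  exact neg_mem h4

end Theta

/-! ## §2 θ-EXTRACTION -/

section Main

variable {p : ℕ} [hp : Fact p.Prime]
variable {S : Type*} [AddCommGroup S] {φ : AddMonoid.End S}
variable {Xd : Type*} [AddCommGroup Xd] [Module (PowerSeries ℤ_[p]) Xd] {toDual : Xd →+ (S →+ AddCircle (1 : ℚ))}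
variable {M : Type*} [AddCommGroup M]

/-- **θ-EXTRACTION (general prime).** For a dual pair `toDual : X ≅ Hom(S, ℚ/ℤ)` of `(S, φ − 1)` with `X ≃ₗ[Λ] Λ` and `J ≥ 1`,
let `B_n` be `M`-valued forms (`j : M ↪ ℚ/ℤ`) on the layers `S_n = S[p^J, φ^{pⁿ} = 1]`, biadditive and `φ`-invariant on
`S_n × S_n`, norm-compatible (`B_n(∑_{i<p} φ^{pⁿ i} s, t) = B_{n+1}(s, t)`), and vanishing on `Q_k(φ)S_{n_k} × Q_k(φ)S_{n_k}` for
polynomials `Q_k` palindromic modulo `ω_{n_k}` with `Q_k(1+T)² = F_k` distinguished and `∀ N ∃ k, N + deg F_k ≤ p^{n_k}`. THEN EVERY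
`B_n` VANISHES IDENTICALLY. (Kim's Prop. 3.15 argument: `θ_n := e(x_{g_n})` at generators `g_n` of the cyclic layers;
`exists_mul_e_sub_e_mem_of_norm`, `e_mul_sq_mem_of_vanishing`, the θ-algebra `forall_mem_omegaIdeal_of_compatible_coeff`,
`form_eq_zero_of_e_mem`.) [cite: BDKim2007, Prop. 3.15, Prop. 3.18] [cite: GreenbergLNM1716, §4 p. 98] -/
theorem forall_layerForm_eq_zero (h : IsDualPair p (φ - 1) toDual) (e : Xd ≃ₗ[PowerSeries ℤ_[p]] PowerSeries ℤ_[p])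
    {J : ℕ} (hJ : 1 ≤ J) (j : M →+ AddCircle (1 : ℚ)) (hj : Function.Injective j) (B : ℕ → S → S → M)
    (hadd₁ : ∀ (n : ℕ) (s₁ s₂ t : S), p ^ J • s₁ = 0 ∧ (φ ^ p ^ n) s₁ = s₁ → p ^ J • s₂ = 0 ∧ (φ ^ p ^ n) s₂ = s₂ →
      p ^ J • t = 0 ∧ (φ ^ p ^ n) t = t → B n (s₁ + s₂) t = B n s₁ t + B n s₂ t)
    (hadd₂ : ∀ (n : ℕ) (s t₁ t₂ : S), p ^ J • s = 0 ∧ (φ ^ p ^ n) s = s → p ^ J • t₁ = 0 ∧ (φ ^ p ^ n) t₁ = t₁ →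
      p ^ J • t₂ = 0 ∧ (φ ^ p ^ n) t₂ = t₂ → B n s (t₁ + t₂) = B n s t₁ + B n s t₂)
    (hinv : ∀ (n : ℕ) (s t : S), p ^ J • s = 0 ∧ (φ ^ p ^ n) s = s → p ^ J • t = 0 ∧ (φ ^ p ^ n) t = t →
      B n (φ s) (φ t) = B n s t)
    (hnorm : ∀ (n : ℕ) (s t : S), p ^ J • s = 0 ∧ (φ ^ p ^ (n + 1)) s = s → p ^ J • t = 0 ∧ (φ ^ p ^ n) t = t →
      B n ((∑ i ∈ range p, (φ ^ p ^ n) ^ i : AddMonoid.End S) s) t = B (n + 1) s t)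
    (nk : ℕ → ℕ) (Q : ℕ → ℤ[X]) (d : ℕ → ℕ) (F : ℕ → ℤ_[p][X])
    (hF : ∀ k, (F k).IsDistinguishedAt (IsLocalRing.maximalIdeal ℤ_[p]))
    (hFQ : ∀ k, (F k : PowerSeries ℤ_[p]) = (aeval (1 + PowerSeries.X : PowerSeries ℤ_[p]) (Q k)) ^ 2)
    (hgap : ∀ N : ℕ, ∃ k, N + (F k).natDegree ≤ p ^ nk k)
    (hpal : ∀ k, (1 + PowerSeries.X : PowerSeries ℤ_[p]) ^ d k *
        aeval ((1 + PowerSeries.X : PowerSeries ℤ_[p]) ^ (p ^ nk k - 1)) (Q k) - aeval (1 + PowerSeries.X : PowerSeries ℤ_[p]) (Q k) ∈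
      Ideal.span {(((X + 1 : ℤ_[p][X]) ^ p ^ nk k - 1 : ℤ_[p][X]) : PowerSeries ℤ_[p])})
    (hV : ∀ (k : ℕ) (s t : S), p ^ J • s = 0 ∧ (φ ^ p ^ nk k) s = s → p ^ J • t = 0 ∧ (φ ^ p ^ nk k) t = t →
      B (nk k) (aeval φ (Q k) s) (aeval φ (Q k) t) = 0) :
    ∀ (n : ℕ) (s t : S), p ^ J • s = 0 ∧ (φ ^ p ^ n) s = s → p ^ J • t = 0 ∧ (φ ^ p ^ n) t = t → B n s t = 0 := by
  have hAex := fun n ↦ exists_layerSubgroup φ p (p ^ n) J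
  choose A hA using hAex
  have hadd₁' : ∀ n, ∀ s₁ ∈ A n, ∀ s₂ ∈ A n, ∀ t ∈ A n, B n (s₁ + s₂) t = B n s₁ t + B n s₂ t :=
    fun n s₁ h₁ s₂ h₂ t ht ↦ hadd₁ n s₁ s₂ t ((hA n s₁).mp h₁) ((hA n s₂).mp h₂) ((hA n t).mp ht)
  have hadd₂' : ∀ n, ∀ s ∈ A n, ∀ t₁ ∈ A n, ∀ t₂ ∈ A n, B n s (t₁ + t₂) = B n s t₁ + B n s t₂ :=
    fun n s hs t₁ h₁ t₂ h₂ ↦ hadd₂ n s t₁ t₂ ((hA n s).mp hs) ((hA n t₁).mp h₁) ((hA n t₂).mp h₂)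
  have hinv' : ∀ n, ∀ s ∈ A n, ∀ t ∈ A n, B n (φ s) (φ t) = B n s t :=
    fun n s hs t ht ↦ hinv n s t ((hA n s).mp hs) ((hA n t).mp ht)
  have hnorm' : ∀ n, ∀ s ∈ A (n + 1), ∀ t ∈ A n, B n ((∑ i ∈ range p, (φ ^ p ^ n) ^ i : AddMonoid.End S) s) t = B (n + 1) s t :=
    fun n s hs t ht ↦ hnorm n s t ((hA (n + 1) s).mp hs) ((hA n t).mp ht)
  have hV' : ∀ k, ∀ s ∈ A (nk k), ∀ t ∈ A (nk k), B (nk k) (aeval φ (Q k) s) (aeval φ (Q k) t) = 0 :=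
    fun k s hs t ht ↦ hV k s t ((hA _ s).mp hs) ((hA _ t).mp ht)
  -- generators of the cyclic layers
  have hgex := fun n ↦ exists_generator_torsionBy_omega h e hJ n
  choose g hg using hgex
  have hgA : ∀ n, g n ∈ A n := fun n ↦ (hA n _).mpr (hg n).1
  have hgen : ∀ n, ∀ t ∈ A n, ∃ c : Fin (p ^ n) → ℕ, t = ∑ i, c i • (φ ^ (i : ℕ)) (g n) := fun n t ht ↦ by
    obtain ⟨c, -, hc⟩ := (hg n).2.2 t ((hA n t).mp ht)
    exact ⟨c, hc⟩
  -- the encodings `x n t`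
  have hxex : ∀ (n : ℕ) (t : S), ∃ x : Xd, t ∈ A n → ∀ s ∈ A n, toDual x s = j (B n s t) := by
    intro n t
    by_cases ht : t ∈ A n
    · obtain ⟨x, hx⟩ := exists_toDual_eq_on h (A n) j (fun s ↦ B n s t) fun s₁ h₁ s₂ h₂ ↦ hadd₁' n s₁ h₁ s₂ h₂ t ht
      exact ⟨x, fun _ ↦ hx⟩
    · exact ⟨0, fun ht' ↦ absurd ht' ht⟩
  choose x hx using hxex
  -- θ-algebra
  have hθ := forall_mem_omegaIdeal_of_compatible_coeff p J (fun n ↦ e (x n (g n)))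
    (exists_mul_sub_mem_of_consecutive p J _ fun n ↦
      exists_mul_e_sub_e_mem_of_norm h e (hA n) (hA (n + 1)) j (B n) (B (n + 1)) (hadd₁' n) (hadd₂' n) (hinv' n)
        (hadd₁' (n + 1)) (hadd₂' (n + 1)) (hinv' (n + 1)) (hnorm' n) (hgA n) (hgA (n + 1)) (hgen (n + 1))
        (hx n (g n) (hgA n)) (hx (n + 1) (g (n + 1)) (hgA (n + 1))))
    nk F hF hgap fun k ↦ by
      rw [hFQ]
      exact e_mul_sq_mem_of_vanishing h e (hA (nk k)) j (B (nk k)) (hadd₁' _) (hadd₂' _) (hinv' _) (hgA _)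
        (hx _ (g _) (hgA _)) (Q k) (hV' k) (hpal k)
  intro n s t hs ht
  exact form_eq_zero_of_e_mem h e (hA n) j hj (B n) (hadd₂' n) (hinv' n) (hgA n) (hgen n) (x n)
    (fun t ht s hs ↦ hx n t ht s hs) (hθ n) ((hA n s).mpr hs) ((hA n t).mpr ht)

end Main

/-! ## §3 The case `p = 2`, plus sign: the LEAD's binder shape -/

section Two

variable {S : Type*} [AddCommGroup S] {φ : AddMonoid.End S}
variable {Xd : Type*} [AddCommGroup Xd] [Module (PowerSeries ℤ_[2]) Xd] {toDual : Xd →+ (S →+ AddCircle (1 : ℚ))}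

/-- **θ-EXTRACTION AT `p = 2` (ISO θ-plan, LEAD g13 2026-08-28 22:31Z decision (1)).** In the (R1)@2 currency
(`IsDualPair 2 (φ − 1) toDual`, `e : X ≃ₗ[Λ] Λ`), let `B n : S → S → ℤ/2^J` be forms on the layers
`S n = {s | 2^J s = 0, ω_n(φ − 1) s = 0}` which are biadditive and `φ`-invariant on `S n × S n` ((P2′)), norm-compatible for
consecutive layers `B n (s + φ^{2ⁿ} s, t) = B (n+1) s t` ((P1′)), and vanish on the honest plus classes of the even layers
`ω̃⁻_{2k}(φ−1)·S(2k) × ω̃⁻_{2k}(φ−1)·S(2k)` ((V), the set-currency of (d′) `iota_image_eq_image_omegaMinus`). THEN `B n ≡ 0` ON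
`S n × S n` FOR EVERY `n` — Kim's Prop. 3.15/3.18 «`E⁺ ⊗ ℚ_p/ℤ_p` is its own exact annihilator» in layer form. (`forall_layerForm_eq_zero`
with `n_k = 2k`, `Q_k(Y) = ∏ Φ_{2^{2k'−1}}(Y)`, `F_k = (ω̃⁻_{2k})²`, palindromy `adjoint_cyclotomicOmegaMinus_sub_mem`, gap
`exists_gap_cyclotomicOmegaMinus_two`, `j = zmodToCircle (2^J)`.) [cite: BDKim2007, Prop. 3.15, Prop. 3.18] -/
theorem forall_layerForm_eq_zero_two (h : IsDualPair 2 (φ - 1) toDual) (e : Xd ≃ₗ[PowerSeries ℤ_[2]] PowerSeries ℤ_[2])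
    (J : ℕ) (B : ℕ → S → S → ZMod (2 ^ J))
    (hadd₁ : ∀ (n : ℕ) (s₁ s₂ t : S), 2 ^ J • s₁ = 0 ∧ aeval (φ - 1) (cyclotomicOmega 2 n) s₁ = 0 →
      2 ^ J • s₂ = 0 ∧ aeval (φ - 1) (cyclotomicOmega 2 n) s₂ = 0 → 2 ^ J • t = 0 ∧ aeval (φ - 1) (cyclotomicOmega 2 n) t = 0 →
      B n (s₁ + s₂) t = B n s₁ t + B n s₂ t)
    (hadd₂ : ∀ (n : ℕ) (s t₁ t₂ : S), 2 ^ J • s = 0 ∧ aeval (φ - 1) (cyclotomicOmega 2 n) s = 0 →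
      2 ^ J • t₁ = 0 ∧ aeval (φ - 1) (cyclotomicOmega 2 n) t₁ = 0 → 2 ^ J • t₂ = 0 ∧ aeval (φ - 1) (cyclotomicOmega 2 n) t₂ = 0 →
      B n s (t₁ + t₂) = B n s t₁ + B n s t₂)
    (hinv : ∀ (n : ℕ) (s t : S), 2 ^ J • s = 0 ∧ aeval (φ - 1) (cyclotomicOmega 2 n) s = 0 →
      2 ^ J • t = 0 ∧ aeval (φ - 1) (cyclotomicOmega 2 n) t = 0 → B n (φ s) (φ t) = B n s t)
    (hnorm : ∀ (n : ℕ) (s t : S), 2 ^ J • s = 0 ∧ aeval (φ - 1) (cyclotomicOmega 2 (n + 1)) s = 0 →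
      2 ^ J • t = 0 ∧ aeval (φ - 1) (cyclotomicOmega 2 n) t = 0 → B n (s + (φ ^ 2 ^ n) s) t = B (n + 1) s t)
    (hV : ∀ (k : ℕ) (s t : S), 2 ^ J • s = 0 ∧ aeval (φ - 1) (cyclotomicOmega 2 (2 * k)) s = 0 →
      2 ^ J • t = 0 ∧ aeval (φ - 1) (cyclotomicOmega 2 (2 * k)) t = 0 →
      B (2 * k) (aeval (φ - 1) (cyclotomicOmegaMinus 2 (2 * k)) s) (aeval (φ - 1) (cyclotomicOmegaMinus 2 (2 * k)) t) = 0) :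
    ∀ (n : ℕ) (s t : S), 2 ^ J • s = 0 ∧ aeval (φ - 1) (cyclotomicOmega 2 n) s = 0 →
      2 ^ J • t = 0 ∧ aeval (φ - 1) (cyclotomicOmega 2 n) t = 0 → B n s t = 0 := by
  haveI : Fact (Nat.Prime 2) := ⟨Nat.prime_two⟩
  -- the two currencies of the layers
  have hω : ∀ (n : ℕ) (s : S), aeval (φ - 1) (cyclotomicOmega 2 n) s = 0 ↔ (φ ^ 2 ^ n) s = s := fun n s ↦ by
    rw [cyclotomicOmega, map_sub, map_pow, map_add, aeval_X, map_one, sub_add_cancel]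
    exact sub_eq_zero
  rcases Nat.eq_zero_or_pos J with rfl | hJ
  · intro n s t _ _
    apply (ZMod.val_eq_zero _).mp
    have := Nat.lt_of_lt_of_eq (ZMod.val_lt (B n s t)) (pow_zero 2)
    omega
  -- the data for `forall_layerForm_eq_zero`
  obtain ⟨Q, hQ⟩ : ∃ Q : ℕ → ℤ[X], ∀ k, Q k = ∏ i ∈ Icc 1 ((2 * k + 1) / 2), cyclotomic (2 ^ (2 * i - 2 + 1)) ℤ :=
    ⟨_, fun k ↦ rfl⟩
  have hQφ : ∀ k, aeval (φ - 1) (cyclotomicOmegaMinus 2 (2 * k)) = aeval φ (Q k) := fun k ↦ by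
    rw [aeval_cyclotomicOmegaMinus_eq_aeval_add_one', sub_add_cancel, hQ k]
  have hQX : ∀ k, aeval (PowerSeries.X : PowerSeries ℤ_[2]) (cyclotomicOmegaMinus 2 (2 * k)) =
      aeval (1 + PowerSeries.X : PowerSeries ℤ_[2]) (Q k) := fun k ↦ by
    rw [aeval_cyclotomicOmegaMinus_eq_aeval_add_one', add_comm, hQ k]
  have hQd : ∀ k, aeval ((1 + PowerSeries.X : PowerSeries ℤ_[2]) ^ (2 ^ (2 * k) - 1) - 1) (cyclotomicOmegaMinus 2 (2 * k)) =
      aeval ((1 + PowerSeries.X : PowerSeries ℤ_[2]) ^ (2 ^ (2 * k) - 1)) (Q k) := fun k ↦ by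
    rw [aeval_cyclotomicOmegaMinus_eq_aeval_add_one', sub_add_cancel, hQ k]
  refine fun n s t hs ht ↦ forall_layerForm_eq_zero h e hJ (zmodToCircle (2 ^ J)) (zmodToCircle_injective (2 ^ J)) B
    (fun n s₁ s₂ t h₁ h₂ h₃ ↦ hadd₁ n s₁ s₂ t ⟨h₁.1, (hω n s₁).mpr h₁.2⟩ ⟨h₂.1, (hω n s₂).mpr h₂.2⟩ ⟨h₃.1, (hω n t).mpr h₃.2⟩)
    (fun n s t₁ t₂ h₁ h₂ h₃ ↦ hadd₂ n s t₁ t₂ ⟨h₁.1, (hω n s).mpr h₁.2⟩ ⟨h₂.1, (hω n t₁).mpr h₂.2⟩ ⟨h₃.1, (hω n t₂).mpr h₃.2⟩)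
    (fun n s t h₁ h₂ ↦ hinv n s t ⟨h₁.1, (hω n s).mpr h₁.2⟩ ⟨h₂.1, (hω n t).mpr h₂.2⟩)
    (fun n s t h₁ h₂ ↦ ?_) (fun k ↦ 2 * k) Q (fun k ↦ ∑ i ∈ Icc 1 ((2 * k + 1) / 2), (2 - 1) * 2 ^ (2 * i - 2))
    (fun k ↦ (cyclotomicOmegaMinus 2 (2 * k)).map (Int.castRingHom ℤ_[2]) ^ 2)
    (fun k ↦ by
      rw [pow_two]
      exact (isDistinguishedAt_map_X_mul_cyclotomicOmegaPlus_and_Minus 2 (2 * k)).2.mul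
        (isDistinguishedAt_map_X_mul_cyclotomicOmegaPlus_and_Minus 2 (2 * k)).2)
    (fun k ↦ by rw [Polynomial.coe_pow, ← aeval_X_eq_coe_map, hQX])
    exists_gap_cyclotomicOmegaMinus_two
    (fun k ↦ by rw [← hQX, ← hQd]; exact adjoint_cyclotomicOmegaMinus_sub_mem 2 (2 * k))
    (fun k s t h₁ h₂ ↦ by
      rw [← hQφ]
      exact hV k s t ⟨h₁.1, (hω _ s).mpr h₁.2⟩ ⟨h₂.1, (hω _ t).mpr h₂.2⟩)
    n s t ⟨hs.1, (hω n s).mp hs.2⟩ ⟨ht.1, (hω n t).mp ht.2⟩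
  -- the consecutive norm at `p = 2` is `1 + φ^{2ⁿ}`
  have e1 : ((∑ i ∈ range 2, (φ ^ 2 ^ n) ^ i : AddMonoid.End S)) s = s + (φ ^ 2 ^ n) s := by
    rw [Finset.sum_range_succ, Finset.sum_range_succ, Finset.sum_range_zero, zero_add, pow_zero, pow_one]
    rfl
  rw [e1]
  exact hnorm n s t ⟨h₁.1, (hω (n + 1) s).mpr h₁.2⟩ ⟨h₂.1, (hω n t).mpr h₂.2⟩

end Two

end Summit.BirchSwinnertonDyer.BirchSwinnertonDyer.Theorems.ResidualThetaLayer.PlusDual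

end
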